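import Summits.AtomisticToContinuum.Crystallization.Theorems.ChargedEnergyGapRoofRelabel
import Summits.AtomisticToContinuum.Crystallization.Theorems.ChargedEnergyGapCapCell
import Summits.AtomisticToContinuum.Crystallization.Theorems.ChargedEnergyGapBasisRepr
import Summits.AtomisticToContinuum.Crystallization.Theorems.ChargedEnergyGapStencilChart
import HarnessLib

/-!
# CostCell (lens-3 g91, NODE 107) — the GENERIC replay lemma of one S2 census cell («Level-B»: a pure box in tuple space) for the deciding leaf (T¹ᶜ)

Line of record: `stmt-AtomisticToContinuum-14231` (`Summit.AtomisticToContinuum.ChargedEnergyGap`, route PricedLinkCensus r3); deciding leaf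
(D¹) `SoloFeetLawQ 130 (1/60000000) 160 (3/100) (679/1000) (691/1000)` ≡ (T¹ᶜ) `StencilChartLawQ …` (NODE 92).  Census coordinates S2 = the
depths of the six octahedron vertices of the hole `d ∘ holeVertex 0` (slot order `0T 0F 1T 1F 2T 2F` of `sum_six`) and `ρ`.

A CELL is a box `lo q ≤ d(holeVertex 0 q) ≤ hi q`, `ρ ∈ [ρ₀, ρ₁]`.  `costCell_law` turns CLOSED RATIONAL HYPOTHESES into the (T¹ᶜ) inequality
`feetHoleCost 160 (3/100) ρ d 0 ≤ domCapK u 160 (3/100) ρ (chargeDepth ρ d 0)` on the whole cell: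
* COST (exact to rounding): `φ` is monotone (tree `depthProfile_monotone`), so the vertex weights lie in the weight box `[L, U]` ⊇ `[φ(lo), φ(hi)]`
  (hypothesis `hWB`: `0 ≤ L q ≤ φ(lo q)` and `φ(hi q) ≤ U q`, closed by `norm_num [depthProfile, smoothStep, min_def, max_def]`); the roof is CONVEX (NODE 106), so `roofVal T75 ≤ R` on the box follows from the 64 CORNER values, each an explicit
  LP representation (tree E8 `roofVal_T75_le_of_repr`; `corners_of_sext` dispatches the 64 literal certificates); `feetHoleCost = (3/100·2ρ)²·roofVal`
  (NODE 106) `≤ (3/100·2ρ₁)²·R`.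
* CAP: the charge depth lies in the `t`-box of the attributed axis (NODE 106 `cap_at_chargeDepth`); per axis either NODE 99 `capCell_lower` certifies
  `capLB·u ≤ domCapK` on that `(ρ,t)` box, or the axis is vacuous (its low pole sum exceeds some high pole sum — arithmetic).
* VERDICT: `(3/100·2ρ₁)²·R ≤ capLB·u` (one rational inequality).
`costCell_law_basis` is the cheaper single-basis variant (NODE 105 rows `Σ_q lowSel (B⁻¹ i q) (L q) (U q) ≥ 0` instead of 64 corners) for cells far
from LP degeneracy; `costCell_chartLaw` restates the conclusion in the binder shape of `StencilChartLawQ` restricted to the cell.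
-/

noncomputable section
open scoped Classical
open Finset
open Literature.MathematicalPhysics.StatisticalMechanics Literature.Geometry.DiscreteGeometry
open Summit.AtomisticToContinuum.Crystallization.Theses.PricedLinkCensus
open Summit.AtomisticToContinuum.Crystallization.Theorems.ChargedEnergyGapNegative

namespace Summit.AtomisticToContinuum.Crystallization.Theorems.ChargedEnergyGapChartDial

/-! ## §107.1 The weight box of a depth box -/

/-- On the depth box the vertex weights lie in the weight box (monotonicity of `φ`). -/
theorem vtxW_mem_box {lo hi L U : Fin 3 × Bool → ℝ} (h : ∀ q, 0 ≤ L q ∧ L q ≤ depthProfile 160 (lo q) ∧ depthProfile 160 (hi q) ≤ U q) {dt : (Fin 3 → ℤ) → ℝ} {w : Fin 3 → ℤ}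
    (hd : ∀ q, lo q ≤ dt (holeVertex w q) ∧ dt (holeVertex w q) ≤ hi q) : ∀ q, L q ≤ vtxW 160 dt w q ∧ vtxW 160 dt w q ≤ U q := fun q =>
  ⟨(h q).2.1.trans (depthProfile_monotone (by norm_num) (hd q).1), (depthProfile_monotone (by norm_num) (hd q).2).trans (h q).2.2⟩

/-! ## §107.2 Dispatching the 64 corners from literal certificates -/

/-- The corner weight vector selected by six Booleans, in `sext` normal form. -/
theorem corner_eq_sext (β : Fin 3 × Bool → Bool) (L U : Fin 3 × Bool → ℝ) :
    (fun q => if β q then U q else L q) =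
      sext (cond (β (0, true)) (U (0, true)) (L (0, true))) (cond (β (0, false)) (U (0, false)) (L (0, false)))
        (cond (β (1, true)) (U (1, true)) (L (1, true))) (cond (β (1, false)) (U (1, false)) (L (1, false)))
        (cond (β (2, true)) (U (2, true)) (L (2, true))) (cond (β (2, false)) (U (2, false)) (L (2, false))) := by
  funext ⟨i, s⟩
  fin_cases i <;> cases s <;> simp [sext]

/-- ★ CORNER DISPATCHER: 64 literal certificates `roofVal T75 (sext …) ≤ R` (one per sign pattern, `cases` order `false < true`, slot `0T` most
significant) give the corner hypothesis of `costCell_law`. -/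
theorem corners_of_sext {L U : Fin 3 × Bool → ℝ} {R : ℝ}
    (h : ∀ a b c d e f : Bool, roofVal T75 (sext (cond a (U (0, true)) (L (0, true))) (cond b (U (0, false)) (L (0, false)))
      (cond c (U (1, true)) (L (1, true))) (cond d (U (1, false)) (L (1, false))) (cond e (U (2, true)) (L (2, true))) (cond f (U (2, false)) (L (2, false)))) ≤ R) :
    ∀ β : Fin 3 × Bool → Bool, roofVal T75 (fun q => if β q then U q else L q) ≤ R := fun β => by
  rw [corner_eq_sext]; exact h _ _ _ _ _ _

/-- One corner certificate from an explicit six-column representation (tree E8), with the value already compared to `R`. -/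
theorem corner_cert {Wv : Fin 3 × Bool → ℝ} {R : ℝ} (w : Fin 6 → (Fin 3 × Bool → ℝ) × ℝ) (g : Fin 6 → Fin 6) (σ : Fin 6 → Fin 8) (lam : Fin 6 → ℝ)
    (hw : ∀ i, w i ∈ T75) (hl : ∀ i, 0 ≤ lam i) (hW : ∀ p, Wv p = ∑ i, lam i * (w i).1 (relabel (g i) (σ i) p)) (hR : ∑ i, lam i * (w i).2 ≤ R) :
    roofVal T75 Wv ≤ R :=
  (roofVal_T75_le_of_repr w g σ lam hw hl hW).trans hR

/-! ## §107.3 The cell law -/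

/-- ★★★ THE S2 COST CELL (corner form).  Hypotheses: weight-box certificates, the 64 corner roof certificates `≤ R`, per-axis cap floors `capLB·u` on the
induced `(ρ, t)` boxes (vacuous axes discharged by their antecedent), and the verdict `(3/100·2ρ₁)²·R ≤ capLB·u`.  Conclusion: the (T¹ᶜ) inequality on
the whole cell. -/
theorem costCell_law {lo hi L U : Fin 3 × Bool → ℝ} {R u capLB ρ₀ ρ₁ : ℝ}
    (hWB : ∀ q, 0 ≤ L q ∧ L q ≤ depthProfile 160 (lo q) ∧ depthProfile 160 (hi q) ≤ U q)
    (hc : ∀ β : Fin 3 × Bool → Bool, roofVal T75 (fun q => if β q then U q else L q) ≤ R)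
    (hρ₀ : 0 < ρ₀)
    (hcap : ∀ a : Fin 3, (∀ b : Fin 3, lo (a, true) + lo (a, false) ≤ hi (b, true) + hi (b, false)) →
      ∀ ρ' t : ℝ, ρ₀ ≤ ρ' → ρ' ≤ ρ₁ → (lo (a, true) + lo (a, false)) / 2 + ρ₀ ≤ t → t ≤ (hi (a, true) + hi (a, false)) / 2 + ρ₁ →
        capLB * u ≤ domCapK u 160 (3 / 100) ρ' t)
    (hfin : (3 / 100 * (2 * ρ₁)) ^ 2 * R ≤ capLB * u) :
    ∀ ρ : ℝ, ρ₀ ≤ ρ → ρ ≤ ρ₁ → ∀ dt : (Fin 3 → ℤ) → ℝ, (∀ q, lo q ≤ dt (holeVertex 0 q) ∧ dt (holeVertex 0 q) ≤ hi q) →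
      feetHoleCost 160 (3 / 100) ρ dt 0 ≤ domCapK u 160 (3 / 100) ρ (chargeDepth ρ dt 0) := by
  intro ρ h₀ h₁ dt hd
  have hρ : 0 < ρ := hρ₀.trans_le h₀
  have hW := vtxW_mem_box hWB hd
  have hLU : ∀ q, L q ≤ U q := fun q => (hW q).1.trans (hW q).2
  have hR : roofVal T75 (vtxW 160 dt 0) ≤ R := roofVal_T75_le_of_corners (fun q => (hWB q).1) hLU hc _ hW
  calc feetHoleCost 160 (3 / 100) ρ dt 0 ≤ (3 / 100 * (2 * ρ₁)) ^ 2 * R := feetHoleCost_le_of_roofVal_le (by norm_num) hρ.le h₁ hR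
    _ ≤ capLB * u := hfin
    _ ≤ domCapK u 160 (3 / 100) ρ (chargeDepth ρ dt 0) := cap_at_chargeDepth hρ h₀ h₁ hcap dt hd

/-- ★★ THE S2 COST CELL (single-basis form, cheaper far from LP degeneracy): the corner hypothesis is replaced by ONE basis (NODE 105: six table rows by
index, `B·B⁻¹ = I`), its six non-negativity rows on the weight box and its price bound. -/
theorem costCell_law_basis {w : Fin 6 → (Fin 3 × Bool → ℝ) × ℝ} {g : Fin 6 → Fin 6} {σ : Fin 6 → Fin 8} {Binv : Fin 6 → (Fin 3 × Bool) → ℝ}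
    (hw : ∀ i, w i ∈ T75) (hB : IsBasisInverse w g σ Binv) {lo hi L U : Fin 3 × Bool → ℝ} {R u capLB ρ₀ ρ₁ : ℝ}
    (hWB : ∀ q, 0 ≤ L q ∧ L q ≤ depthProfile 160 (lo q) ∧ depthProfile 160 (hi q) ≤ U q)
    (hrows : ∀ i, 0 ≤ ∑ q, lowSel (Binv i q) (L q) (U q)) (hR : ∑ q, highSel (basisPrice w Binv q) (L q) (U q) ≤ R)
    (hρ₀ : 0 < ρ₀)
    (hcap : ∀ a : Fin 3, (∀ b : Fin 3, lo (a, true) + lo (a, false) ≤ hi (b, true) + hi (b, false)) →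
      ∀ ρ' t : ℝ, ρ₀ ≤ ρ' → ρ' ≤ ρ₁ → (lo (a, true) + lo (a, false)) / 2 + ρ₀ ≤ t → t ≤ (hi (a, true) + hi (a, false)) / 2 + ρ₁ →
        capLB * u ≤ domCapK u 160 (3 / 100) ρ' t)
    (hfin : (3 / 100 * (2 * ρ₁)) ^ 2 * R ≤ capLB * u) :
    ∀ ρ : ℝ, ρ₀ ≤ ρ → ρ ≤ ρ₁ → ∀ dt : (Fin 3 → ℤ) → ℝ, (∀ q, lo q ≤ dt (holeVertex 0 q) ∧ dt (holeVertex 0 q) ≤ hi q) →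
      feetHoleCost 160 (3 / 100) ρ dt 0 ≤ domCapK u 160 (3 / 100) ρ (chargeDepth ρ dt 0) := by
  intro ρ h₀ h₁ dt hd
  have hρ : 0 < ρ := hρ₀.trans_le h₀
  have hW := vtxW_mem_box hWB hd
  have hR : roofVal T75 (vtxW 160 dt 0) ≤ R :=
    (roofVal_T75_le_on_env hw hB (fun q => (hW q).1) (fun q => (hW q).2) hrows).trans hR
  calc feetHoleCost 160 (3 / 100) ρ dt 0 ≤ (3 / 100 * (2 * ρ₁)) ^ 2 * R := feetHoleCost_le_of_roofVal_le (by norm_num) hρ.le h₁ hR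
    _ ≤ capLB * u := hfin
    _ ≤ domCapK u 160 (3 / 100) ρ (chargeDepth ρ dt 0) := cap_at_chargeDepth hρ h₀ h₁ hcap dt hd

/-- The cell law in the binder shape of (T¹ᶜ) `StencilChartLawQ dK u 160 (3/100) ρlo ρhi` RESTRICTED TO THE CELL (positivity, realisability and the
hole predicate are not needed on a «Level-B» cell and are simply dropped; the covering of the hole tuples by cells is the census assembly, not this file). -/
theorem costCell_chartLaw {lo hi : Fin 3 × Bool → ℝ} {u ρ₀ ρ₁ dK : ℝ}
    (hcell : ∀ ρ : ℝ, ρ₀ ≤ ρ → ρ ≤ ρ₁ → ∀ dt : (Fin 3 → ℤ) → ℝ, (∀ q, lo q ≤ dt (holeVertex 0 q) ∧ dt (holeVertex 0 q) ≤ hi q) →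
      feetHoleCost 160 (3 / 100) ρ dt 0 ≤ domCapK u 160 (3 / 100) ρ (chargeDepth ρ dt 0)) :
    ∀ ρ : ℝ, ρ₀ ≤ ρ → ρ ≤ ρ₁ → ∀ dt : (Fin 3 → ℤ) → ℝ, (∀ q, lo q ≤ dt (holeVertex 0 q) ∧ dt (holeVertex 0 q) ≤ hi q) →
      (∀ p ∈ stencil 0, 0 < dt p) → IsChartRealisable ρ dt → IsTupleHole dK ρ dt →
        feetHoleCost 160 (3 / 100) ρ dt 0 ≤ domCapK u 160 (3 / 100) ρ (chargeDepth ρ dt 0) :=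
  fun ρ h₀ h₁ dt hd _ _ _ => hcell ρ h₀ h₁ dt hd

end Summit.AtomisticToContinuum.Crystallization.Theorems.ChargedEnergyGapChartDial
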